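import Summits.BirchSwinnertonDyer.Rank1Residual.P2.PrintCf2DeuringGaloisSummand
import Summits.BirchSwinnertonDyer.BirchSwinnertonDyer.Theorems.PrintCf2SplitBadTwoAvatarValuesTwo
import Summits.BirchSwinnertonDyer.BirchSwinnertonDyer.Theorems.PrintCf2SplitBadTwoGalConjInfinityType
import Summits.BirchSwinnertonDyer.BirchSwinnertonDyer.Theorems.PrintCf2SplitBadTwoFramePinningAtTwo
import Literature.NumberTheory.EllipticCurves.HeckeGrossencharakterFunctionalEquation
import HarnessLib

set_option autoImplicit false

/-!
# Crux `PrintCf2.SplitBadTwoRankOneOfFacts` (stmt-BirchSwinnertonDyer-20368), road α v10.3, S3b′ TWIST step: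
# (D-Gal) READ THROUGH THE FRAME'S `ι` — Frobenius at an unramified `w ≠ v̄` acts on the pinned summand
# `W* = ↥(endEigenPrimaryTorsion 2 π r₀)` at level `2ᵏ` as an integer `N ≡ ι⁻¹((ψ∘c)(ϖ_w)) (mod 2ᵏ ℤ₂)`,
# i.e. through the geometric `2`-adic avatar (w.r.t. `ι`) of `λ = (ψ ∘ c)⁻¹`

Cell `bsd-print-cf2`, typer seat ty2 g30 (the DISCHARGE INTERFACE, `P2/` = the typer's Summits-side files),
serving crux stmt-BirchSwinnertonDyer-20368 (`Theorems/PrintCf2SplitBadTwo*`). HONEST FRAMING: THEOREMS ONLY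
(no definition, no named fact, no `sorry`); the Literature named fact `Deuring_galoisAction_cmPrimaryTorsion_split`
(p667198, statement-only, Rubin LNM 1716 Thm. 5.15 / Cor. 5.16 AS PRINTED) is the displayed HYPOTHESIS `hD`;
nothing here closes a crux or a stub; BSD is not proved by any of this; beyond-print theorem: no.

THE TARGET (width memo `Cruxes/SplitBadTwoRankOneOfFacts/S3B-TWIST-RECIPE-w5g2.md` §2, (D-Gal), verbatim):
"for every finite `w ∤ 2` of good reduction and every arithmetic Frobenius `Φ` at `w`, `Φ • x = N • x` on
`W*[2ᵏ]` with `N ≡ ι⁻¹((ψ_W∘c)(ϖ_w))`". The companion file `PrintCf2DeuringGaloisSummand.lean` (p670251)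
proved this in `𝓞_K`-currency: `N ≡ a_w (mod v̄ᵏ)` with `wi.embedding a_w = ψ.valueAtUniformizer w`.
THIS FILE converts the congruence into the `ι`-currency of the v10 stubs (`IsPAdicAvatarOf ι`): with the
frame hypothesis `hι : ∀ wi k, k ∈ v ↔ ‖ι⁻¹(wi.embedding k)‖ < 1` («`ι` induces `v`»),

* §1 (valuation bookkeeping, any ultrametric field): a ring map `φ` with `k ∈ 𝔪 ↔ ‖φ k‖ < 1` for a maximal
  `𝔪` has `‖φ‖ ≤ 1` (`norm_map_le_one_of_forall_mem_iff`) and `= 1` off `𝔪`; in a quadratic field with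
  `2 = v v̄` (`mul_eq_span_two_of_split`), `x ∈ vᵏ ⟹ ‖φ x‖ ≤ ‖2‖ᵏ` (`norm_map_le_norm_two_pow_of_mem_pow`);
  (`‖2‖ = 2⁻¹` in `ℚ̄₂` is inlined; cf. `ResidualThetaLayer.norm_two_padicAlgCl`);
* §2 `norm_intCast_sub_symm_valueAtUniformizer_galConj_le`: for conj-equivariant `ψ`, `c ≠ 1`, `c • v̄ = v`:
  `N ≡ a (mod v̄ᵏ)` and `wi.embedding a = ψ(ϖ_w)` ⟹ `‖N − ι⁻¹((ψ∘c)(ϖ_w))‖ ≤ 2⁻ᵏ` in `ℚ̄₂`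
  (`(ψ∘c)(ϖ_w) = conj ψ(ϖ_w) = wi.embedding (c a)` and `c(N − a) = N − c a ∈ vᵏ`);
  `exists_padicInt_coe_eq_symm_valueAtUniformizer_galConj`: that value is a `2`-adic INTEGER `z`
  (`K = ℚ(√−7) ↪ ℚ₂`, -w4's `QuadraticPart.ringHom_apply_mem_range_algebraMap_two`, and `‖·‖ ≤ 1`);
* §3 `exists_padicInt_smul_eq_of_isArithFrobAt_of_pinned` — **(D-Gal) in `ι`-currency**: granted `hD`, in
  every v10 frame with `hι`, for every `w ≠ v̄` at which `ψ` is unramified there is `z : ℤ₂` with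
  `z = ι⁻¹((HeckeCharacter.galConj c ψ).valueAtUniformizer w)` in `ℚ̄₂` such that every arithmetic Frobenius
  `σ` at a prime above `w` acts on `↥((W.baseChange K).endEigenPrimaryTorsion 2 π r₀)` at level `2ᵏ` as EVERY
  integer `N` with `N − z ∈ 2ᵏ ℤ₂`, and such an `N` exists at every level — exactly the level-wise scalars
  `CocyclicScalar.exists_continuousMonoidHom_forall_smul_eq` (p664116) packages, now NAMED by `λ = (ψ∘c)⁻¹`:
  `symm_valueAtUniformizer_inv_galConj_inv` records `z = (ι⁻¹(λ(ϖ_w)))⁻¹`, the ARITHMETIC-Frobenius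
  eigenvalue that `IsPAdicAvatarOf ι λ r` prescribes (`X − C (ι.symm (λ.valueAtUniformizer w))⁻¹`).

What this does NOT do: build the continuous character / the avatar `r` itself, treat `w = v` (where `ψ`
ramifies in the frame), or prove the print. presearch: not applicable (bookkeeping over tree theorems; no
stub or fact filed).

References: K. Rubin, LNM 1716 (1999), §5 Thm. 5.15, Cor. 5.16; [SilvermanATAEC1994] Ch. II Thm. 9.2,
Prop. 10.4; [SerreAbelianLadic1968] Ch. II §2.7; [Serre1973] Ch. II §3.3 Thm. 4; [NeukirchANT1999] Ch. I §8–§9.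
-/

noncomputable section

open scoped Classical Pointwise ComplexConjugate
open NumberField IsDedekindDomain WeierstrassCurve Field
open Literature.NumberTheory.EllipticCurves Literature.NumberTheory.GaloisRepresentations
open Literature.NumberTheory.Automorphic
open Summit.BirchSwinnertonDyer.BirchSwinnertonDyer.Theorems.PrintCf2

namespace Summit.BirchSwinnertonDyer.Rank1Residual.P2.DeuringGaloisSummandAvatar

/-! ## §1 Valuation bookkeeping for a place-inducing ring map -/

section Valuation

variable {R : Type*} [CommRing R] {F : Type*} [NormedField F] [IsUltrametricDist F]

/-- **A ring map inducing a maximal ideal is bounded by `1`**: if `k ∈ 𝔪 ↔ ‖φ k‖ < 1` for a maximal ideal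
`𝔪`, then `‖φ y‖ ≤ 1` for all `y` (were `‖φ y‖ > 1`, an inverse `t` of `y` modulo `𝔪` would have
`‖φ t‖ < 1`, so `t ∈ 𝔪` and `1 = t y + s ∈ 𝔪`). [cite: NeukirchANT1999, Ch. II §3 Prop. (3.8) (valuation rings)] -/
theorem norm_map_le_one_of_forall_mem_iff {I : Ideal R} (hI : I.IsMaximal) (φ : R →+* F)
    (hφ : ∀ y : R, y ∈ I ↔ ‖φ y‖ < 1) (y : R) : ‖φ y‖ ≤ 1 := by
  by_contra! hy
  have hyI : y ∉ I := fun h ↦ lt_irrefl (1 : ℝ) (hy.trans ((hφ y).1 h))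
  obtain ⟨t, s, hs, hts⟩ := hI.exists_inv hyI
  have hs1 : ‖φ s‖ < 1 := (hφ s).1 hs
  have h1 : ‖φ t‖ * ‖φ y‖ = 1 := by
    have e : φ t * φ y = 1 + -φ s := by
      rw [← map_mul, ← sub_eq_add_neg, eq_sub_iff_add_eq, ← map_add, hts, map_one]
    rw [← norm_mul, e, IsUltrametricDist.norm_add_eq_max_of_norm_ne_norm
      (by rw [norm_one, norm_neg]; exact hs1.ne'), norm_one, norm_neg, max_eq_left hs1.le]
  have ht1 : ‖φ t‖ < 1 := by
    by_contra! ht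
    have : (1 : ℝ) < ‖φ t‖ * ‖φ y‖ := lt_of_lt_of_le hy (le_mul_of_one_le_left (norm_nonneg _) ht)
    linarith
  exact hI.ne_top (I.eq_top_iff_one.mpr (hts ▸ I.add_mem (I.mul_mem_right y ((hφ t).2 ht1)) hs))

/-- Off the ideal the map is a unit of norm `1`. [cite: NeukirchANT1999, Ch. II §3 Prop. (3.8)] -/
theorem norm_map_eq_one_of_not_mem {I : Ideal R} (hI : I.IsMaximal) (φ : R →+* F)
    (hφ : ∀ y : R, y ∈ I ↔ ‖φ y‖ < 1) {y : R} (hy : y ∉ I) : ‖φ y‖ = 1 :=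
  le_antisymm (norm_map_le_one_of_forall_mem_iff hI φ hφ y) (not_lt.1 (mt (hφ y).2 hy))

variable {K : Type} [Field K] [NumberField K] {v vbar : HeightOneSpectrum (𝓞 K)}

/-- **`v v̄ = (2)`** for the two places `v ≠ v̄` above `2` of a quadratic field (`(2) ⊆ v ∩ v̄ = v v̄`,
and `N(v) = N(v̄) = 2`, `N((2)) = 4`). [cite: NeukirchANT1999, Ch. I §8 Prop. (8.2)–(8.3)] -/
theorem mul_eq_span_two_of_split (hK2 : Module.finrank ℚ K = 2)
    (hv : ((2 : ℕ) : 𝓞 K) ∈ v.asIdeal) (hvbar : ((2 : ℕ) : 𝓞 K) ∈ vbar.asIdeal) (hne : vbar ≠ v) :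
    v.asIdeal * vbar.asIdeal = Ideal.span {(2 : 𝓞 K)} := by
  have hne' : v.asIdeal ≠ vbar.asIdeal := fun h ↦ hne (HeightOneSpectrum.ext h).symm
  have hcop : v.asIdeal ⊔ vbar.asIdeal = ⊤ := Ideal.IsMaximal.coprime_of_ne v.isMaximal vbar.isMaximal hne'
  have hle : Ideal.span {(2 : 𝓞 K)} ≤ v.asIdeal * vbar.asIdeal := by
    rw [Ideal.mul_eq_inf_of_coprime hcop, Ideal.span_le, Set.singleton_subset_iff]
    exact ⟨by exact_mod_cast hv, by exact_mod_cast hvbar⟩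
  obtain ⟨J, hJ⟩ := Ideal.dvd_iff_le.mpr hle
  have h2 : Ideal.absNorm v.asIdeal = 2 := DeuringGaloisSummand.absNorm_eq_two_of_split hK2 hvbar hv hne.symm
  have h2' : Ideal.absNorm vbar.asIdeal = 2 := DeuringGaloisSummand.absNorm_eq_two_of_split hK2 hv hvbar hne
  have hn : Ideal.absNorm (Ideal.span {(2 : 𝓞 K)}) = 4 := by
    rw [Ideal.absNorm_span_singleton]
    have h := Algebra.norm_algebraMap (S := 𝓞 K) (2 : ℤ)
    rw [NumberField.RingOfIntegers.rank, hK2, map_ofNat] at h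
    rw [h]; norm_num
  have hJ1 : Ideal.absNorm J = 1 := by
    have h := congrArg Ideal.absNorm hJ
    rw [hn, map_mul, map_mul, h2, h2'] at h
    omega
  rw [Ideal.absNorm_eq_one_iff] at hJ1
  rw [hJ, hJ1, Ideal.mul_top]

/-- **`x ∈ vᵏ ⟹ ‖φ x‖ ≤ ‖2‖ᵏ`** for a ring map `φ` inducing `v` (`2 = v v̄` in a quadratic field): with
`u ∈ v̄ ∖ v` (`‖φ u‖ = 1`), `uᵏ x ∈ (v v̄)ᵏ = (2ᵏ)`, so `‖φ x‖ = ‖2‖ᵏ ‖φ t‖ ≤ ‖2‖ᵏ`.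
[cite: NeukirchANT1999, Ch. I §8 Prop. (8.3) and Ch. II §3] -/
theorem norm_map_le_norm_two_pow_of_mem_pow (hK2 : Module.finrank ℚ K = 2)
    (hv : ((2 : ℕ) : 𝓞 K) ∈ v.asIdeal) (hvbar : ((2 : ℕ) : 𝓞 K) ∈ vbar.asIdeal) (hne : vbar ≠ v)
    (φ : 𝓞 K →+* F) (hφ : ∀ y : 𝓞 K, y ∈ v.asIdeal ↔ ‖φ y‖ < 1) {x : 𝓞 K} {k : ℕ}
    (hx : x ∈ v.asIdeal ^ k) : ‖φ x‖ ≤ ‖(2 : F)‖ ^ k := by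
  have hnle : ¬ vbar.asIdeal ≤ v.asIdeal := fun h ↦
    hne (HeightOneSpectrum.ext (vbar.isMaximal.eq_of_le v.isPrime.ne_top h))
  obtain ⟨u, huvbar, huv⟩ := Set.not_subset.mp hnle
  have hu1 : ‖φ u‖ = 1 := norm_map_eq_one_of_not_mem v.isMaximal φ hφ huv
  have hmem : u ^ k * x ∈ Ideal.span {(2 : 𝓞 K) ^ k} := by
    rw [← Ideal.span_singleton_pow, ← mul_eq_span_two_of_split hK2 hv hvbar hne, mul_pow,
      mul_comm (v.asIdeal ^ k)]
    exact Ideal.mul_mem_mul (Ideal.pow_mem_pow huvbar k) hx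
  obtain ⟨t, ht⟩ := Ideal.mem_span_singleton'.mp hmem
  have e : φ u ^ k * φ x = (2 : F) ^ k * φ t := by
    rw [← map_pow, ← map_mul, ← ht, map_mul, map_pow, map_ofNat, mul_comm]
  have h := congrArg norm e
  rw [norm_mul, norm_pow, hu1, one_pow, one_mul, norm_mul, norm_pow] at h
  rw [h]
  exact mul_le_of_le_one_right (pow_nonneg (norm_nonneg _) _)
    (norm_map_le_one_of_forall_mem_iff v.isMaximal φ hφ t)

end Valuation

/-! ## §2 Reading `a (mod v̄ᵏ)` in `ℚ̄₂` through `ι` -/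

section Reading

variable {K : Type} [Field K] [NumberField K] {v vbar : HeightOneSpectrum (𝓞 K)}

/-- **The congruence read through `ι`.** `K` imaginary quadratic with `2 = v v̄`, `c ≠ 1`, `ι : ℚ̄₂ ≃ ℂ`
inducing `v` through every complex embedding (`hι`), `ψ` conj-equivariant: if `wi.embedding a = ψ(ϖ_w)`
and `N ≡ a (mod v̄ᵏ)`, then `‖N − ι⁻¹((ψ∘c)(ϖ_w))‖ ≤ 2⁻ᵏ` in `ℚ̄₂` — because `(ψ∘c)(ϖ_w) = conj ψ(ϖ_w)
= wi.embedding (c a)` and `c (N − a) = N − c a ∈ c v̄ᵏ = vᵏ`. [cite: SilvermanATAEC1994, Ch. II Thm. 9.2]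
[cite: NeukirchANT1999, Ch. I §9 Prop. (9.1)] -/
theorem norm_intCast_sub_symm_valueAtUniformizer_galConj_le (hK : IsImaginaryQuadratic K)
    (hv : ((2 : ℕ) : 𝓞 K) ∈ v.asIdeal) (hvbar : ((2 : ℕ) : 𝓞 K) ∈ vbar.asIdeal) (hne : vbar ≠ v)
    (ι : PadicAlgCl 2 ≃+* ℂ)
    (hι : ∀ (wi : InfinitePlace K) (k : 𝓞 K), k ∈ v.asIdeal ↔ ‖ι.symm (wi.embedding (k : K))‖ < 1)
    (c : K ≃ₐ[ℚ] K) (hc : c ≠ 1) {ψ : HeckeCharacter K} (heq : IsHeckeConjEquivariant c ψ)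
    {w : HeightOneSpectrum (𝓞 K)} (wi : InfinitePlace K) {a : 𝓞 K}
    (ha : wi.embedding (a : K) = ψ.valueAtUniformizer w) {k : ℕ} {N : ℤ}
    (hN : ((N : 𝓞 K) - a) ∈ vbar.asIdeal ^ k) :
    ‖(N : PadicAlgCl 2) - ι.symm ((HeckeCharacter.galConj c ψ).valueAtUniformizer w)‖ ≤ (2 : ℝ)⁻¹ ^ k := by
  set φ : 𝓞 K →+* PadicAlgCl 2 :=
    ((ι.symm : ℂ ≃+* PadicAlgCl 2).toRingHom.comp wi.embedding).comp (algebraMap (𝓞 K) K) with hφdef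
  have hφapp : ∀ y : 𝓞 K, φ y = ι.symm (wi.embedding (y : K)) := fun y ↦ rfl
  have hφ : ∀ y : 𝓞 K, y ∈ v.asIdeal ↔ ‖φ y‖ < 1 := fun y ↦ by rw [hφapp]; exact hι wi y
  -- transport the congruence from `v̄` to `v = c • v̄`
  have hmem : ((N : 𝓞 K) - c • a) ∈ v.asIdeal ^ k := by
    have h1 : c • ((N : 𝓞 K) - a) ∈ c • (vbar.asIdeal ^ k) := Ideal.smul_mem_pointwise_smul_iff.mpr hN
    rw [smul_pow', ← HeightOneSpectrum.smul_asIdeal, FramePinning.smul_eq_of_frame hK.1 c hc hvbar hv hne.symm,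
      smul_sub] at h1
    have hcN : c • (N : 𝓞 K) = N := map_intCast (MulSemiringAction.toRingHom (K ≃ₐ[ℚ] K) (𝓞 K) c) N
    rwa [hcN] at h1
  have hle := norm_map_le_norm_two_pow_of_mem_pow hK.1 hv hvbar hne φ hφ hmem
  have hval : φ ((N : 𝓞 K) - c • a) =
      (N : PadicAlgCl 2) - ι.symm ((HeckeCharacter.galConj c ψ).valueAtUniformizer w) := by
    rw [map_sub, map_intCast, hφapp, RingOfIntegers.coe_algEquiv_smul,
      QuadraticPart.embedding_apply_eq_conj_of_ne_one hK c hc wi, ha, heq.valueAtUniformizer_galConj' w]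
  rw [← hval]
  refine hle.trans (le_of_eq ?_)
  -- `‖2‖ = 2⁻¹` in `ℚ̄₂` (also `ResidualThetaLayer.norm_two_padicAlgCl`, not imported here)
  haveI : Fact (Nat.Prime 2) := ⟨Nat.prime_two⟩
  have h2 : ((2 : ℚ_[2]) : PadicAlgCl 2) = 2 := map_ofNat _ 2
  rw [← h2, PadicAlgCl.norm_extends]
  congr 1
  exact_mod_cast Padic.norm_p (p := 2)

/-- **`ι⁻¹((ψ∘c)(ϖ_w))` is a `2`-adic integer** when `ψ(ϖ_w) = wi.embedding a`, `a ∈ 𝓞_K`, `K ∋ √−7`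
quadratic and `ι` induces `v`: `K ↪ ℚ₂` under every map to `ℚ̄₂` (-w4 `ringHom_apply_mem_range_algebraMap_two`)
and `‖ι⁻¹(wi.embedding (c a))‖ ≤ 1`. [cite: Serre1973, Ch. II §3.3 Thm. 4] [cite: SerreAbelianLadic1968, Ch. II §2.7] -/
theorem exists_padicInt_coe_eq_symm_valueAtUniformizer_galConj (hK : IsImaginaryQuadratic K)
    {θ : K} (hθ : θ ^ 2 = -7) (ι : PadicAlgCl 2 ≃+* ℂ)
    (hι : ∀ (wi : InfinitePlace K) (k : 𝓞 K), k ∈ v.asIdeal ↔ ‖ι.symm (wi.embedding (k : K))‖ < 1)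
    (c : K ≃ₐ[ℚ] K) (hc : c ≠ 1) {ψ : HeckeCharacter K} (heq : IsHeckeConjEquivariant c ψ)
    {w : HeightOneSpectrum (𝓞 K)} (wi : InfinitePlace K) {a : 𝓞 K}
    (ha : wi.embedding (a : K) = ψ.valueAtUniformizer w) :
    ∃ z : ℤ_[2], ((z : ℚ_[2]) : PadicAlgCl 2) = ι.symm ((HeckeCharacter.galConj c ψ).valueAtUniformizer w) := by
  haveI : Fact (Nat.Prime 2) := ⟨Nat.prime_two⟩
  set φK : K →+* PadicAlgCl 2 := (ι.symm : ℂ ≃+* PadicAlgCl 2).toRingHom.comp wi.embedding with hφKdef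
  have hval : ι.symm ((HeckeCharacter.galConj c ψ).valueAtUniformizer w) = φK (((c • a : 𝓞 K) : K)) := by
    rw [heq.valueAtUniformizer_galConj' w, ← ha, ← QuadraticPart.embedding_apply_eq_conj_of_ne_one hK c hc wi,
      ← RingOfIntegers.coe_algEquiv_smul]
    rfl
  obtain ⟨t, ht⟩ := QuadraticPart.ringHom_apply_mem_range_algebraMap_two hK.1 hθ φK (((c • a : 𝓞 K) : K))
  have ht1 : ‖t‖ ≤ 1 := by
    rw [← PadicAlgCl.norm_extends, ht]
    exact norm_map_le_one_of_forall_mem_iff v.isMaximal (φK.comp (algebraMap (𝓞 K) K))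
      (fun y ↦ hι wi y) (c • a)
  exact ⟨⟨t, ht1⟩, by rw [hval, ← ht]⟩

/-- **Avatar normalisation check**: `ι⁻¹((ψ∘c)(ϖ_w)) = (ι⁻¹(λ(ϖ_w)))⁻¹` for `λ = (ψ∘c)⁻¹` — the scalar of
this file is the ARITHMETIC-Frobenius eigenvalue `(ι.symm (λ.valueAtUniformizer w))⁻¹` that
`IsPAdicAvatarOf ι λ r` prescribes (`r.HasFrobCharpolyAt w (X − C (ι.symm (λ.valueAtUniformizer w))⁻¹)`).
[cite: CastellaHsieh2018, §3.3 (p. 9)] -/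
theorem symm_valueAtUniformizer_inv_galConj_inv (ι : PadicAlgCl 2 ≃+* ℂ) (c : K ≃ₐ[ℚ] K)
    (ψ : HeckeCharacter K) (w : HeightOneSpectrum (𝓞 K)) :
    (ι.symm (((HeckeCharacter.galConj c ψ)⁻¹).valueAtUniformizer w))⁻¹ =
      ι.symm ((HeckeCharacter.galConj c ψ).valueAtUniformizer w) := by
  rw [HeckeCharacter.valueAtUniformizer_inv', map_inv₀, inv_inv]

end Reading

/-! ## §3 (D-Gal) in `ι`-currency on the pinned summand -/

section Frame

open Summit.BirchSwinnertonDyer.BirchSwinnertonDyer.Theorems.RamifiedSevenEllipticUnits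

variable {K : Type} [Field K] [NumberField K]
variable {d : ℤ} {W : WeierstrassCurve ℚ} [W.IsElliptic] [W.IsGloballyMinimal] {C : VariableChange ℚ}
  {v vbar : HeightOneSpectrum (𝓞 K)} {ψ : HeckeCharacter K}

/-- **(D-Gal) read through `ι`, on the pinned summand.** Granted the print `hD`: in every v10 frame with
`ι` inducing `v` (`hι`), for every finite `w ≠ v̄` at which `ψ` is unramified there is a `2`-adic integer
`z` with `z = ι⁻¹((ψ∘c)(ϖ_w))` in `ℚ̄₂` (`= (ι⁻¹(λ(ϖ_w)))⁻¹`, `λ = (ψ∘c)⁻¹`,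
`symm_valueAtUniformizer_inv_galConj_inv`) such that for every prime `𝔔 ∣ w` of `\bar ℤ_K` and every
arithmetic Frobenius `σ` at `𝔔`, at every level `k`: (i) some integer `N` with `N − z ∈ 2ᵏ ℤ₂` has
`σ • x = N • x` for all `x ∈ W* = ↥((W.baseChange K).endEigenPrimaryTorsion 2 π r₀)` with `2ᵏ x = 0`, and
(ii) EVERY integer `N` with `N − z ∈ 2ᵏ ℤ₂` does. (Rubin Cor. 5.16 (ii) + `c v̄ = v` + conj-equivariance of
`ψ`, derived in the frame by `DeuringShape.isHeckeConjEquivariant_of_pinned`.)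
[cite: Rubin1999, §5 Cor. 5.16 (i)–(ii)] [cite: SilvermanATAEC1994, Ch. II Thm. 9.2] -/
theorem exists_padicInt_smul_eq_of_isArithFrobAt_of_pinned
    (hD : Deuring_galoisAction_cmPrimaryTorsion_split)
    (hd0 : d ≠ 0) (hC : C • W = cm7.quadraticTwist (d : ℚ)) (hK : IsImaginaryQuadratic K)
    (hv : ((2 : ℕ) : 𝓞 K) ∈ v.asIdeal) (hvbar : ((2 : ℕ) : 𝓞 K) ∈ vbar.asIdeal) (hne : vbar ≠ v)
    (ι : PadicAlgCl 2 ≃+* ℂ)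
    (hι : ∀ (wi : InfinitePlace K) (k : 𝓞 K), k ∈ v.asIdeal ↔ ‖ι.symm (wi.embedding (k : K))‖ < 1)
    (c : K ≃ₐ[ℚ] K) (hc : c ≠ 1) (hψ : ψ.HasInfinityType (fun _ ↦ 1) (fun _ ↦ 0))
    (hL : ∀ s : ℂ, 3 / 2 < s.re → heckeLFunction ψ s = W.LSeries s)
    (π : (W.baseChange K).endRing) (hrel : (π : AddMonoid.End (W.baseChange K).geomPoints) * π = π - 2)
    {r₀ : ℤ_[2]} (hr₀ : r₀ * r₀ = r₀ - 2)
    (hpin : ∀ τ ∈ GreenbergSelmer.inertia v,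
      ∀ x : ↥((W.baseChange K).endEigenPrimaryTorsion 2 π r₀), τ • x = x ∨ τ • x = -x)
    {w : HeightOneSpectrum (𝓞 K)} (hw : w ≠ vbar) (hunr : ψ.IsUnramifiedAt w) :
    ∃ z : ℤ_[2], ((z : ℚ_[2]) : PadicAlgCl 2) = ι.symm ((HeckeCharacter.galConj c ψ).valueAtUniformizer w) ∧
      ∀ 𝔔 ∈ w.primesAbove, ∀ σ : absoluteGaloisGroup K, IsArithFrobAt (𝓞 K) σ 𝔔 → ∀ k : ℕ,
        (∃ N : ℤ, ((N : ℤ_[2]) - z) ∈ (Ideal.span {(2 : ℤ_[2]) ^ k} : Ideal ℤ_[2]) ∧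
          ∀ x : ↥((W.baseChange K).endEigenPrimaryTorsion 2 π r₀), 2 ^ k • x = 0 → σ • x = N • x) ∧
        (∀ N : ℤ, ((N : ℤ_[2]) - z) ∈ (Ideal.span {(2 : ℤ_[2]) ^ k} : Ideal ℤ_[2]) →
          ∀ x : ↥((W.baseChange K).endEigenPrimaryTorsion 2 π r₀), 2 ^ k • x = 0 → σ • x = N • x) := by
  haveI : Fact (Nat.Prime 2) := ⟨Nat.prime_two⟩
  obtain ⟨⟨θ, hθ⟩, -⟩ := FramePinning.exists_sq_eq_neg_seven_of_frame hd0 W hC hK hv hvbar hne hL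
  have heqv : IsHeckeConjEquivariant c ψ := DeuringShape.isHeckeConjEquivariant_of_pinned hK c hc hψ W (3 / 2) hL
  -- an infinite place to read `ψ(ϖ_w)` in `K`
  obtain ⟨wi⟩ : Nonempty (InfinitePlace K) := inferInstance
  obtain ⟨a, ha, -, hact⟩ := DeuringGaloisSummand.exists_int_smul_eq_of_isArithFrobAt_of_pinned hD hd0 hC hK hv
    hvbar hne c hc hψ hL π hrel hr₀ hpin hw hunr wi
  obtain ⟨z, hz⟩ := exists_padicInt_coe_eq_symm_valueAtUniformizer_galConj (v := v) hK hθ ι hι c hc heqv wi ha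
  -- the `𝓞_K`-congruence implies the `ℤ₂`-congruence
  have hcong : ∀ {k : ℕ} {N : ℤ}, ((N : 𝓞 K) - a) ∈ vbar.asIdeal ^ k →
      ((N : ℤ_[2]) - z) ∈ (Ideal.span {(2 : ℤ_[2]) ^ k} : Ideal ℤ_[2]) := by
    intro k N hN
    have h := norm_intCast_sub_symm_valueAtUniformizer_galConj_le hK hv hvbar hne ι hι c hc heqv wi ha hN
    have key : ‖((((N : ℤ_[2]) - z : ℤ_[2]) : ℚ_[2]) : PadicAlgCl 2)‖ ≤ (2 : ℝ) ^ (-(k : ℤ)) := by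
      have e : ((((N : ℤ_[2]) - z : ℤ_[2]) : ℚ_[2]) : PadicAlgCl 2) =
          (N : PadicAlgCl 2) - ι.symm ((HeckeCharacter.galConj c ψ).valueAtUniformizer w) := by
        rw [← hz, PadicInt.coe_sub, PadicInt.coe_intCast, map_sub, map_intCast]
      rw [e, zpow_neg, zpow_natCast, ← inv_pow]
      exact h
    rw [PadicAlgCl.norm_extends, ← PadicInt.norm_def] at key
    have hmem := (PadicInt.norm_le_pow_iff_mem_span_pow _ k).mp (by exact_mod_cast key)
    simpa using hmem
  refine ⟨z, hz, fun 𝔔 h𝔔 σ hσ k ↦ ?_⟩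
  obtain ⟨N₀, hN₀, hact₀⟩ := hact 𝔔 h𝔔 σ hσ k
  refine ⟨⟨N₀, hcong hN₀, hact₀⟩, fun N hN x hx ↦ ?_⟩
  rw [hact₀ x hx]
  exact CMPrimes.zsmul_eq_zsmul_of_pow_dvd_sub hx (CMPrimes.pow_dvd_sub_of_sub_mem_span (hcong hN₀) hN)

end Frame

end Summit.BirchSwinnertonDyer.Rank1Residual.P2.DeuringGaloisSummandAvatar

end
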